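import Summits.QuantumAdvantage.AdviceFreeQNC0.CrossFreeWindow
import HarnessLib

/-!
# Cell qa-qnc0 (rung F-Q1, route RingFrame, crux α `RingToElim`): the cross-free window
# theorem — mixed-game bound and the walk-strategy bound (square-root form)

Continuation of `CrossFreeWindow.lean` (the fibre identity `mixedWinU_crossFree_eq_cell`):

* `mixedWinU_crossFree_le` — the mixed game on `L + H + M` bits whose `x`-half interior selectors
  (`0 < g < L`) do not read `z` and whose `z`-half interior selectors (`L + H < g < L + H + M`)
  do not read `x` — everything else of degree `≤ D`, unrestricted — is won on at most
  `(1 − η₁)·2^{L+H+M}` window contents (`L, M ≥ n₀`, `D ≤ c₁√L, c₁√M`, every charge, every even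
  outside triple): fibrewise in the middle block `h`, the cross-cell obstruction
  `crossCell_obstruction`, then Fubini over `h`;
* `ringWinU_crossFree_sqrt_le` — **THE CROSS-FREE WINDOW THEOREM**: a walk strategy on
  `p + (L + H + M) + q` bits, all selectors of degree `≤ D ≤ c₁√L, c₁√M`, with a window
  `x ++ h ++ z` such that the selectors strictly inside the `x`-half do not read `z` and those
  strictly inside the `z`-half do not read `x`, wins the ring game in walk coordinates on at most
  `θ·2ⁿ` inputs, every charge.

The cell's theorem (prover qn-prover-3, 2026-08-27); not in print.  Polylog form and the
LOCAL-RULES corollary: `CrossFreeWindowPolylog.lean`.  WHAT THIS IS NOT: general α untouched;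
no separation.

## References

* S. Srinivasan, *A robust version of Hegedűs's lemma, with applications*, TheoretiCS 2 (2023),
  Lemma 3.1 [Srinivasan2023] (through `crossCell_obstruction`).
-/

noncomputable section

namespace Summit.QuantumAdvantage.AdviceFreeQNC0

open Finset
open Literature.Computability.MetaComplexity Literature.Computability.MetaComplexity.Smolensky

variable {L H M : ℕ}

/-- Fubini for a three-block window read through the middle block: the count over
`{0,1}^{L+H+M}` is the sum over `h` of the counts over `w' = x ++ z`. -/
private theorem card_filter_eq_sum_mid (Q : (Fin (L + H + M) → Bool) → Prop) [DecidablePred Q] :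
    (univ.filter fun w : Fin (L + H + M) → Bool => Q w).card =
      ∑ h : Fin H → Bool, (univ.filter fun w' : Fin (L + M) → Bool =>
        Q (glue3 (fun i : Fin L => w' (Fin.castAdd M i)) h (fun j : Fin M => w' (Fin.natAdd L j)))).card := by
  have hL : (univ.filter fun w : Fin (L + H + M) → Bool => Q w).card =
      ∑ x : Fin L → Bool, ∑ z : Fin M → Bool, ∑ h : Fin H → Bool, (if Q (glue3 x h z) then 1 else 0) := by
    rw [card_filter_eq_sum_glue3]
    refine Finset.sum_congr rfl fun x _ => Finset.sum_congr rfl fun z _ => ?_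
    rw [Finset.card_filter]
  have hR : ∀ h : Fin H → Bool, (univ.filter fun w' : Fin (L + M) → Bool =>
      Q (glue3 (fun i : Fin L => w' (Fin.castAdd M i)) h (fun j : Fin M => w' (Fin.natAdd L j)))).card =
      ∑ x : Fin L → Bool, ∑ z : Fin M → Bool, (if Q (glue3 x h z) then 1 else 0) := by
    intro h
    rw [card_filter_eq_sum_left]
    refine Finset.sum_congr rfl fun x _ => ?_
    rw [Finset.card_filter]
    refine Finset.sum_congr rfl fun z _ => ?_
    simp only [left_of_append, right_of_append]
  rw [hL]
  symm
  calc ∑ h : Fin H → Bool, (univ.filter fun w' : Fin (L + M) → Bool =>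
        Q (glue3 (fun i : Fin L => w' (Fin.castAdd M i)) h (fun j : Fin M => w' (Fin.natAdd L j)))).card
      = ∑ h : Fin H → Bool, ∑ x : Fin L → Bool, ∑ z : Fin M → Bool,
          (if Q (glue3 x h z) then 1 else 0) := Finset.sum_congr rfl fun h _ => hR h
    _ = ∑ x : Fin L → Bool, ∑ h : Fin H → Bool, ∑ z : Fin M → Bool,
          (if Q (glue3 x h z) then 1 else 0) := Finset.sum_comm
    _ = ∑ x : Fin L → Bool, ∑ z : Fin M → Bool, ∑ h : Fin H → Bool,
          (if Q (glue3 x h z) then 1 else 0) := Finset.sum_congr rfl fun x _ => Finset.sum_comm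

/-- Evenness of the cell family `Θ` along a row or a column: four even triples combined. -/
private theorem xor3_theta : ∀ (p0 p1 p2 b e0 e1 e2 m0 m1 m2 d f0 f1 f2 : Bool),
    xor p0 (xor p1 p2) = false → xor e0 (xor e1 e2) = false → xor m0 (xor m1 m2) = false →
    xor f0 (xor f1 f2) = false →
    xor (xor p0 (xor (b && e0) (xor m0 (d && f0))))
      (xor (xor p1 (xor (b && e1) (xor m1 (d && f1))))
        (xor p2 (xor (b && e2) (xor m2 (d && f2))))) = false := by
  decide

/-- **The mixed game with cross-free halves is hard.** [cite: Srinivasan2023, Lemma 3.1] -/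
theorem mixedWinU_crossFree_le :
    ∃ η₁ : ℝ, 0 < η₁ ∧ ∃ c₁ : ℝ, 0 < c₁ ∧ ∃ n₀ : ℕ, ∀ L H M : ℕ, n₀ ≤ L → n₀ ≤ M →
      ∀ D : ℕ, (D : ℝ) ≤ c₁ * Real.sqrt L → (D : ℝ) ≤ c₁ * Real.sqrt M →
      ∀ (c : ℕ) (P : ℕ → (Fin (L + H + M) → Bool) → Bool)
        (y : Fin (L + H + M + 1) → (Fin (L + H + M) → Bool) → Bool),
        (∀ r, HasDeg (P r) D) → (∀ w, xor (P 0 w) (xor (P 1 w) (P 2 w)) = false) →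
        (∀ g, HasDeg (y g) D) →
        (∀ g : Fin (L + H + M + 1), 0 < g.val → g.val < L →
          ∀ (x : Fin L → Bool) (h : Fin H → Bool) (z z' : Fin M → Bool),
            y g (glue3 x h z) = y g (glue3 x h z')) →
        (∀ g : Fin (L + H + M + 1), L + H < g.val → g.val < L + H + M →
          ∀ (x x' : Fin L → Bool) (h : Fin H → Bool) (z : Fin M → Bool),
            y g (glue3 x h z) = y g (glue3 x' h z)) →
        ((univ.filter fun w : Fin (L + H + M) → Bool => mixedWinU c P y w = true).card : ℝ) ≤
          (1 - η₁) * (2 : ℝ) ^ (L + H + M) := by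
  obtain ⟨η₁, hη₁, c₁, hc₁, n₀, Hobs⟩ := crossCell_obstruction
  refine ⟨η₁, hη₁, c₁, hc₁, max n₀ 1, ?_⟩
  intro L H M hL hM D hDL hDM c P y hP hPe hy hX hZ
  have hn₀L : n₀ ≤ L := le_trans (le_max_left _ _) hL
  have hn₀M : n₀ ≤ M := le_trans (le_max_left _ _) hM
  have hL1 : 0 < L := lt_of_lt_of_le Nat.one_pos (le_trans (le_max_right _ _) hL)
  have hM1 : 0 < M := lt_of_lt_of_le Nat.one_pos (le_trans (le_max_right _ _) hM)
  rw [card_filter_eq_sum_mid]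
  push_cast
  -- the bound on each fibre `h`
  have hfib : ∀ h : Fin H → Bool, ((univ.filter fun w' : Fin (L + M) → Bool =>
      mixedWinU c P y (glue3 (fun i : Fin L => w' (Fin.castAdd M i)) h
        (fun j : Fin M => w' (Fin.natAdd L j))) = true).card : ℝ) ≤ (1 - η₁) * (2 : ℝ) ^ (L + M) := by
    intro h
    set sx : Fin (L + H + M + 1) → (Fin L → Bool) → Bool :=
      fun g x => y g (glue3 x h (fun _ => false)) with hsx
    set sz : Fin (L + H + M + 1) → (Fin M → Bool) → Bool :=
      fun g z => y g (glue3 (fun _ => false) h z) with hsz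
    have hsx' : ∀ g : Fin (L + H + M + 1), 0 < g.val → g.val < L →
        ∀ (x : Fin L → Bool) (z : Fin M → Bool), y g (glue3 x h z) = sx g x :=
      fun g h1 h2 x z => hX g h1 h2 x h z _
    have hsz' : ∀ g : Fin (L + H + M + 1), L + H < g.val → g.val < L + H + M →
        ∀ (x : Fin L → Bool) (z : Fin M → Bool), y g (glue3 x h z) = sz g z :=
      fun g h1 h2 x z => hZ g h1 h2 x _ h z
    refine Hobs L M hn₀L hn₀M D hDL hDM
      (fun i j w' => xor (P (((i + j) % 3 + wt h) % 3)
          (glue3 (fun i : Fin L => w' (Fin.castAdd M i)) h (fun j : Fin M => w' (Fin.natAdd L j))))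
        (xor (y 0 (glue3 (fun i : Fin L => w' (Fin.castAdd M i)) h (fun j : Fin M => w' (Fin.natAdd L j)))
              && decide ((c + wt h + (i + j) % 3) % 3 ≠ 0))
          (xor (decide ((((univ : Finset (Fin (L + H + M + 1))).filter fun g =>
                  L ≤ g.val ∧ g.val ≤ L + H).filter fun g =>
                  (y g (glue3 (fun i : Fin L => w' (Fin.castAdd M i)) h
                      (fun j : Fin M => w' (Fin.natAdd L j))) &&
                    decide ((c + wt h + g.val + (2 * i + j) % 3 + wtPrefix h (g.val - L)) % 3 ≠ 0))
                    = true).card % 2 = 1))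
            (y (Fin.last (L + H + M)) (glue3 (fun i : Fin L => w' (Fin.castAdd M i)) h
                (fun j : Fin M => w' (Fin.natAdd L j))) &&
              decide ((c + (L + H + M) + 2 * wt h + 2 * ((i + j) % 3)) % 3 ≠ 0)))))
      (fun r x => decide ((((univ : Finset (Fin (L + H + M + 1))).filter fun g =>
          0 < g.val ∧ g.val < L).filter fun g =>
          (sx g x && decide ((c + wt h + g.val + r + wtPrefix x g.val) % 3 ≠ 0)) = true).card % 2 = 1))
      (fun r z => decide ((((univ : Finset (Fin (L + H + M + 1))).filter fun g =>
          L + H < g.val ∧ g.val < L + H + M).filter fun g =>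
          (sz g z && decide ((c + 2 * wt h + g.val + r + wtPrefix z (g.val - (L + H))) % 3 ≠ 0))
            = true).card % 2 = 1))
      (fun w' => mixedWinU c P y (glue3 (fun i : Fin L => w' (Fin.castAdd M i)) h
        (fun j : Fin M => w' (Fin.natAdd L j))))
      ?_ ?_ ?_ ?_ ?_ ?_
    · -- degrees of `Θ`
      intro i j
      refine hasDeg_xor (hasDeg_glueBlocks h (hP _)) (hasDeg_xor
        (hasDeg_and_const' (hasDeg_glueBlocks h (hy 0)) _) (hasDeg_xor ?_
        (hasDeg_and_const' (hasDeg_glueBlocks h (hy _)) _)))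
      exact hasDeg_parity _ (fun g (w' : Fin (L + M) → Bool) =>
          y g (glue3 (fun i : Fin L => w' (Fin.castAdd M i)) h (fun j : Fin M => w' (Fin.natAdd L j))) &&
            decide ((c + wt h + g.val + (2 * i + j) % 3 + wtPrefix h (g.val - L)) % 3 ≠ 0))
        fun g _ => hasDeg_and_const' (hasDeg_glueBlocks h (hy g)) _
    · -- rows of `Θ` are even
      intro i w' hi
      have hPr := xor3_perm (fun r => P r (glue3 (fun i : Fin L => w' (Fin.castAdd M i)) h
          (fun j : Fin M => w' (Fin.natAdd L j)))) (hPe _) ((i + 0) % 3 + wt h) ((i + 1) % 3 + wt h)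
          ((i + 2) % 3 + wt h) (by omega) (by omega) (by omega)
      have h0 := xor3_decide_mod3' (c + wt h + (i + 0) % 3) (c + wt h + (i + 1) % 3)
        (c + wt h + (i + 2) % 3) (by omega) (by omega) (by omega)
      have hm := xor3_parity_of_pointwise (((univ : Finset (Fin (L + H + M + 1))).filter fun g =>
          L ≤ g.val ∧ g.val ≤ L + H))
        (fun g => y g (glue3 (fun i : Fin L => w' (Fin.castAdd M i)) h (fun j : Fin M => w' (Fin.natAdd L j))))
        (fun g => decide ((c + wt h + g.val + (2 * i + 0) % 3 + wtPrefix h (g.val - L)) % 3 ≠ 0))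
        (fun g => decide ((c + wt h + g.val + (2 * i + 1) % 3 + wtPrefix h (g.val - L)) % 3 ≠ 0))
        (fun g => decide ((c + wt h + g.val + (2 * i + 2) % 3 + wtPrefix h (g.val - L)) % 3 ≠ 0))
        (fun g => xor3_decide_mod3' _ _ _ (by omega) (by omega) (by omega))
      have hE := xor3_decide_mod3' (c + (L + H + M) + 2 * wt h + 2 * ((i + 0) % 3))
        (c + (L + H + M) + 2 * wt h + 2 * ((i + 1) % 3)) (c + (L + H + M) + 2 * wt h + 2 * ((i + 2) % 3))
        (by omega) (by omega) (by omega)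
      exact xor3_theta _ _ _ _ _ _ _ _ _ _ _ _ _ _ hPr h0 hm hE
    · -- columns of `Θ` are even
      intro j w' hj
      have hPr := xor3_perm (fun r => P r (glue3 (fun i : Fin L => w' (Fin.castAdd M i)) h
          (fun j : Fin M => w' (Fin.natAdd L j)))) (hPe _) ((0 + j) % 3 + wt h) ((1 + j) % 3 + wt h)
          ((2 + j) % 3 + wt h) (by omega) (by omega) (by omega)
      have h0 := xor3_decide_mod3' (c + wt h + (0 + j) % 3) (c + wt h + (1 + j) % 3)
        (c + wt h + (2 + j) % 3) (by omega) (by omega) (by omega)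
      have hm := xor3_parity_of_pointwise (((univ : Finset (Fin (L + H + M + 1))).filter fun g =>
          L ≤ g.val ∧ g.val ≤ L + H))
        (fun g => y g (glue3 (fun i : Fin L => w' (Fin.castAdd M i)) h (fun j : Fin M => w' (Fin.natAdd L j))))
        (fun g => decide ((c + wt h + g.val + (2 * 0 + j) % 3 + wtPrefix h (g.val - L)) % 3 ≠ 0))
        (fun g => decide ((c + wt h + g.val + (2 * 1 + j) % 3 + wtPrefix h (g.val - L)) % 3 ≠ 0))
        (fun g => decide ((c + wt h + g.val + (2 * 2 + j) % 3 + wtPrefix h (g.val - L)) % 3 ≠ 0))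
        (fun g => xor3_decide_mod3' _ _ _ (by omega) (by omega) (by omega))
      have hE := xor3_decide_mod3' (c + (L + H + M) + 2 * wt h + 2 * ((0 + j) % 3))
        (c + (L + H + M) + 2 * wt h + 2 * ((1 + j) % 3)) (c + (L + H + M) + 2 * wt h + 2 * ((2 + j) % 3))
        (by omega) (by omega) (by omega)
      exact xor3_theta _ _ _ _ _ _ _ _ _ _ _ _ _ _ hPr h0 hm hE
    · -- `A` is even
      intro x
      exact xor3_parity_of_pointwise _ (fun g => sx g x)
        (fun g => decide ((c + wt h + g.val + 0 + wtPrefix x g.val) % 3 ≠ 0))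
        (fun g => decide ((c + wt h + g.val + 1 + wtPrefix x g.val) % 3 ≠ 0))
        (fun g => decide ((c + wt h + g.val + 2 + wtPrefix x g.val) % 3 ≠ 0))
        (fun g => xor3_decide_mod3' _ _ _ (by omega) (by omega) (by omega))
    · -- `B` is even
      intro z
      exact xor3_parity_of_pointwise _ (fun g => sz g z)
        (fun g => decide ((c + 2 * wt h + g.val + 0 + wtPrefix z (g.val - (L + H))) % 3 ≠ 0))
        (fun g => decide ((c + 2 * wt h + g.val + 1 + wtPrefix z (g.val - (L + H))) % 3 ≠ 0))
        (fun g => decide ((c + 2 * wt h + g.val + 2 + wtPrefix z (g.val - (L + H))) % 3 ≠ 0))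
        (fun g => xor3_decide_mod3' _ _ _ (by omega) (by omega) (by omega))
    · -- the cell formula
      intro x z
      simp only [left_of_append, right_of_append]
      exact mixedWinU_crossFree_eq_cell hL1 hM1 c P y h sx sz hsx' hsz' x z
  calc ∑ h : Fin H → Bool, ((univ.filter fun w' : Fin (L + M) → Bool =>
        mixedWinU c P y (glue3 (fun i : Fin L => w' (Fin.castAdd M i)) h
          (fun j : Fin M => w' (Fin.natAdd L j))) = true).card : ℝ)
      ≤ ∑ _h : Fin H → Bool, (1 - η₁) * (2 : ℝ) ^ (L + M) := Finset.sum_le_sum fun h _ => hfib h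
    _ = (1 - η₁) * (2 : ℝ) ^ (L + H + M) := by
        simp only [Finset.sum_const, Finset.card_univ, Fintype.card_fun, Fintype.card_bool,
          Fintype.card_fin, nsmul_eq_mul]
        push_cast
        rw [pow_add, pow_add, pow_add]
        ring

/-! ### The cross-free window theorem for walk strategies -/

variable {p q : ℕ}

/-- **THE CROSS-FREE WINDOW THEOREM (square-root form).**  There are `θ < 1`, `c₁ > 0`, `n₀`
such that for all `p, L, H, M, q` with `L, M ≥ n₀`, every `D ≤ c₁√L`, `D ≤ c₁√M`, every charge
and every walk strategy on `p + (L + H + M) + q` bits with all selectors of degree `≤ D` such that,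
for the window `x ++ h ++ z` starting at `p`, the selectors at the positions strictly inside the
`x`-block do not read `z` and those strictly inside the `z`-block do not read `x` (they may read
their own block, `h`, and everything outside; the middle positions, the window ends and the
outside are unrestricted), the ring game in walk coordinates is won on at most
`θ·2^{p+(L+H+M)+q}` inputs. [cite: Srinivasan2023, Lemma 3.1] -/
theorem ringWinU_crossFree_sqrt_le :
    ∃ θ : ℝ, θ < 1 ∧ ∃ c₁ : ℝ, 0 < c₁ ∧ ∃ n₀ : ℕ, ∀ p L H M q : ℕ, n₀ ≤ L → n₀ ≤ M →
      ∀ D : ℕ, (D : ℝ) ≤ c₁ * Real.sqrt L → (D : ℝ) ≤ c₁ * Real.sqrt M →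
      ∀ (c : ℕ) (y : Fin (p + (L + H + M) + q + 1) → (Fin (p + (L + H + M) + q) → Bool) → Bool),
        (∀ g, HasDeg (y g) D) →
        (∀ g : Fin (p + (L + H + M) + q + 1), p < g.val → g.val < p + L →
          ∀ (a : Fin p → Bool) (x : Fin L → Bool) (h : Fin H → Bool) (z z' : Fin M → Bool)
            (b : Fin q → Bool), y g (glue3 a (glue3 x h z) b) = y g (glue3 a (glue3 x h z') b)) →
        (∀ g : Fin (p + (L + H + M) + q + 1), p + (L + H) < g.val → g.val < p + (L + H + M) →
          ∀ (a : Fin p → Bool) (x x' : Fin L → Bool) (h : Fin H → Bool) (z : Fin M → Bool)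
            (b : Fin q → Bool), y g (glue3 a (glue3 x h z) b) = y g (glue3 a (glue3 x' h z) b)) →
        ((univ.filter fun u : Fin (p + (L + H + M) + q) → Bool => ringWinU c y u = true).card : ℝ) ≤
          θ * (2 : ℝ) ^ (p + (L + H + M) + q) := by
  obtain ⟨η₁, hη₁, c₁, hc₁, n₀, Hmix⟩ := mixedWinU_crossFree_le
  refine ⟨1 - η₁, by linarith, c₁, hc₁, n₀, ?_⟩
  intro p L H M q hL hM D hDL hDM c y hdeg hX hZ
  rw [card_filter_eq_sum_glue3]
  push_cast
  have hfib : ∀ (a : Fin p → Bool) (b : Fin q → Bool),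
      ((univ.filter fun v : Fin (L + H + M) → Bool => ringWinU c y (glue3 a v b) = true).card : ℝ) ≤
        (1 - η₁) * (2 : ℝ) ^ (L + H + M) := by
    intro a b
    have heq : (univ.filter fun v : Fin (L + H + M) → Bool => ringWinU c y (glue3 a v b) = true) =
        univ.filter fun v : Fin (L + H + M) → Bool =>
          mixedWinU (inCharge c a b) (outParity y c a b) (inStrategy y a b) v = true :=
      Finset.filter_congr fun v _ => by rw [ringWinU_glue3_eq_mixedWinU]
    rw [heq]
    refine Hmix L H M hL hM D hDL hDM (inCharge c a b) (outParity y c a b) (inStrategy y a b)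
      (hasDeg_outParity c y hdeg a b) (fun v => outParity_even c y a b v)
      (hasDeg_inStrategy y hdeg a b) ?_ ?_
    · intro g' h1 h2 x h z z'
      exact hX ⟨p + g'.val, by omega⟩ (show p < p + g'.val by omega)
        (show p + g'.val < p + L by omega) a x h z z' b
    · intro g' h1 h2 x x' h z
      exact hZ ⟨p + g'.val, by omega⟩ (show p + (L + H) < p + g'.val by omega)
        (show p + g'.val < p + (L + H + M) by omega) a x x' h z b
  calc ∑ a : Fin p → Bool, ∑ b : Fin q → Bool,
        ((univ.filter fun v : Fin (L + H + M) → Bool => ringWinU c y (glue3 a v b) = true).card : ℝ)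
      ≤ ∑ _a : Fin p → Bool, ∑ _b : Fin q → Bool, (1 - η₁) * (2 : ℝ) ^ (L + H + M) :=
        Finset.sum_le_sum fun a _ => Finset.sum_le_sum fun b _ => hfib a b
    _ = (1 - η₁) * (2 : ℝ) ^ (p + (L + H + M) + q) := by
        simp only [Finset.sum_const, Finset.card_univ, Fintype.card_fun, Fintype.card_bool,
          Fintype.card_fin, nsmul_eq_mul]
        push_cast
        ring

end Summit.QuantumAdvantage.AdviceFreeQNC0
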